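import Literature.AlgebraicGeometry.Motives.JacobianPrimeThetaDivisorExists
import HarnessLib

/-!
# A Cartier divisor with an effective multiple is effective (normality); multiplicity one in the strong form

Layer `Literature/AlgebraicGeometry/Motives` (namespaces `….Motives.CartierDivisor`, `….Motives.Jacobian`).  KERNEL ONLY (theorems; no definition,
no named fact, no instance, no `sorry`).

Görtz–Wedhorn, *Algebraic Geometry I*, Def. 11.20 / 11.26 (4) (pp. 301, 304): a Cartier divisor `(U_i, f_i)` is effective iff every `f_i` is
regular on `U_i`, i.e. `f_i ∈ 𝒪_{X,x}` for `x ∈ U_i`.  On a NORMAL integral scheme the local rings are integrally closed in `K(X)`, so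
`f^m ∈ 𝒪_{X,x}` (`m ≥ 1`) forces `f ∈ 𝒪_{X,x}`; regular schemes are normal (regular ⇒ factorial, Auslander–Buchsbaum, ★
`Scheme.IsRegular.uniqueFactorizationMonoid_stalk`; factorial ⇒ integrally closed, Mathlib).  Hence:

* §1 `CartierDivisor.SameDivisor.isEffective` — a presentation of the same divisor as an effective one is effective (any integral `X`);
  **`CartierDivisor.IsEffective.of_smul`** — on a regular integral scheme, `m • E ≥ 0` with `m ≥ 1` implies `E ≥ 0`
  (Mathlib `IsIntegrallyClosed.exists_algebraMap_eq_of_isIntegral_pow`).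
* §2 the multiplicity-one statements of ★ `CartierDivisorReducedMultiplicityOne` / ★ `JacobianPrimeThetaDivisor` in the STRONG form (no
  effectivity asked of `E`): **`CartierDivisor.IsEffective.forall_eq_one_of_isReduced`** (reduced `Z(D)`, irreducible support ⇒
  `D ≈ m • E ⇒ m = 1`) — the hypothesis `hone` of ★ (j1) `…idealSheaf_eq_primeDivisorIdeal_of_forall_eq_one`; and for the prime theta divisor of a
  Jacobian **`Jacobian.forall_eq_one_primeTheta`**, `Jacobian.forall_eq_one_primeTheta_of_isSmoothProjective` (complex, `h1` discharged by ★ p767754).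

Use (cell `hodgecm-mathlib`, D-0151; crux HLiu418 = stmt-HodgeConjecture-24832, VI-7 side road G5: the `hone`∕`hmul1` sockets of (V7-b) (A-p02) and
of the (H) transfer of (V7-c) (A-p06) in either quantifier shape).  COUNT-NEUTRAL.  HC_CM is proved only modulo the 7 printed citations until
rung 0 closes; this file moves no book by itself.

## References
* [GortzWedhorn2020] U. Görtz, T. Wedhorn, *Algebraic Geometry I*, 2nd ed. (2020), Def. 11.20 (p. 301), Remark 11.27 (p. 305), Thm. 11.40 (2).
* [Matsumura1987] H. Matsumura, *Commutative Ring Theory* (1987), Thm. 20.3 (Auslander–Buchsbaum) and Thm. 19.4 / §9 (regular ⇒ normal).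
* [Hartshorne1977] R. Hartshorne, *Algebraic Geometry* (1977), II.6 Prop. 6.11 and Remark 6.11.2 (pp. 141–142); II.6 Prop. 6.3A.
-/

set_option autoImplicit false

noncomputable section

universe u

open CategoryTheory AlgebraicGeometry TopologicalSpace

namespace Literature.AlgebraicGeometry.Motives

open Literature.AlgebraicGeometry.Resolution

namespace CartierDivisor

open RatFn

variable {X : Scheme.{u}} [IsIntegral X] {D E : CartierDivisor X}

/-! ## §1 Effectivity passes along `SameDivisor` and down from multiples -/

/-- **A presentation of the same divisor as an effective presentation is effective**: `g_j = f_i · (g_j / f_i)` with `f_i ∈ 𝒪_x` and `g_j / f_i`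
a unit at `x ∈ U_i ∩ V_j`. [cite: GortzWedhorn2020, Def. 11.20 (p. 301)] -/
theorem SameDivisor.isEffective (h : D.SameDivisor E) (hD : D.IsEffective) : E.IsEffective := by
  intro j x hxj
  obtain ⟨i, hxi⟩ := D.covers x
  have hu : IsUnitAt x (E.f j / D.f i) := by
    have := (h i j x hxi hxj).inv
    rwa [inv_div] at this
  have hreg := (hD i x hxi).mul hu.isRegularAt
  rwa [mul_div_cancel₀ _ (D.f_ne_zero i)] at hreg

/-- **On a regular integral scheme a Cartier divisor with an effective positive multiple is effective**: if `f^m ∈ 𝒪_{X,x}` with `m ≥ 1`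
then `f ∈ 𝒪_{X,x}`, the regular local ring `𝒪_{X,x}` being factorial (Auslander–Buchsbaum) hence integrally closed in `K(X) = Frac 𝒪_{X,x}`.
[cite: Matsumura1987, Thm. 20.3 (Auslander–Buchsbaum)] [cite: GortzWedhorn2020, Def. 11.20 (p. 301)] -/
theorem IsEffective.of_smul (hX : Scheme.IsRegular X) {m : ℕ} (hm : 0 < m) (h : (m • E).IsEffective) : E.IsEffective := by
  intro i x hxi
  haveI : UniqueFactorizationMonoid (X.presheaf.stalk x) := hX.uniqueFactorizationMonoid_stalk x
  obtain ⟨t, ht⟩ := h i x hxi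
  have hint : IsIntegral (X.presheaf.stalk x) (E.f i ^ m) := by
    rw [← smul_f, ← ht]
    exact isIntegral_algebraMap
  obtain ⟨y, hy⟩ := IsIntegrallyClosed.exists_algebraMap_eq_of_isIntegral_pow (K := X.functionField) hm hint
  exact ⟨y, hy⟩

/-- `D ≈ m • E` with `D ≥ 0`, `m ≥ 1` on a regular integral scheme ⇒ `E ≥ 0`. [cite: GortzWedhorn2020, Def. 11.20 (p. 301)] -/
theorem IsEffective.isEffective_of_sameDivisor_smul (hX : Scheme.IsRegular X) (hD : D.IsEffective) {m : ℕ} (hm : 0 < m)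
    (h : D.SameDivisor (m • E)) : E.IsEffective :=
  IsEffective.of_smul hX hm (h.isEffective hD)

/-! ## §2 Multiplicity one, strong form -/

section Regular

variable [IsNoetherian X]

/-- **Reduced `Z(D)` with irreducible support ⇒ `D` is not a proper multiple of ANY Cartier divisor** (strong form of ★
`IsEffective.eq_one_of_sameDivisor_smul_of_isReduced`: effectivity of `E` follows from §1).  This is the hypothesis `hone` of ★ (j1)
`IsEffective.idealSheaf_eq_primeDivisorIdeal_of_forall_eq_one`. [cite: Hartshorne1977, II.6 Prop. 6.11 and Remark 6.11.2 (pp. 141–142)]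
[cite: GortzWedhorn2020, Thm. 11.40 (2)] -/
theorem IsEffective.forall_eq_one_of_isReduced (hX : Scheme.IsRegular X) (hD : D.IsEffective) [IsReduced hD.idealSheaf.subscheme]
    (hirr : IsIrreducible (D.nonvanishing 1)ᶜ) :
    ∀ (E : CartierDivisor X) (m : ℕ), 0 < m → D.SameDivisor (m • E) → m = 1 :=
  fun _ _ hm h => hD.eq_one_of_sameDivisor_smul_of_isReduced hX hirr (hD.isEffective_of_sameDivisor_smul hX hm h) hm h

omit [AlgebraicGeometry.IsNoetherian X] in
/-- Weak (effective) multiplicity one ⇒ strong multiplicity one, for an effective divisor on a regular integral scheme. [cite: GortzWedhorn2020, Def. 11.20 (p. 301)] -/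
theorem IsEffective.forall_eq_one_of_forall_isEffective_eq_one (hX : Scheme.IsRegular X) (hD : D.IsEffective)
    (hone : ∀ (E : CartierDivisor X) (m : ℕ), E.IsEffective → 0 < m → D.SameDivisor (m • E) → m = 1) :
    ∀ (E : CartierDivisor X) (m : ℕ), 0 < m → D.SameDivisor (m • E) → m = 1 :=
  fun E m hm h => hone E m (hD.isEffective_of_sameDivisor_smul hX hm h) hm h

end Regular

end CartierDivisor

/-! ## §3 Strong HONE for the prime theta divisor of a Jacobian -/

namespace Jacobian

variable {k : Type u} [Field k] {C : SchemeOver k} [GeometricallyIrreducible C.hom] (𝒥 : Jacobian C) (P : AlgPoints C k)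

/-- **Strong HONE for `Θ_W = [W̃_{dim J−1}(P)]`**: `Θ_W ≈ m • E`, `m ≥ 1 ⇒ m = 1` for ANY Cartier divisor `E` (★ p767770 weak form + normality of
the regular `J`). [cite: Hartshorne1977, II.6 Prop. 6.11 and Remark 6.11.2 (pp. 141–142)] -/
theorem forall_eq_one_primeTheta (h1 : Order.coheight (𝒥.isIrreducible_brillNoetherLocus P (𝒥.J.dim - 1)).genericPoint = 1) :
    letI := 𝒥.J.isNoetherian_left
    ∀ (E : CartierDivisor 𝒥.J.X.left) (m : ℕ), 0 < m →
      (CartierDivisor.ofIsEffectiveCartier (primeDivisorIdeal (𝒥.isIrreducible_brillNoetherLocus P (𝒥.J.dim - 1)).genericPoint)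
        (isEffectiveCartier_primeDivisorIdeal_of_isRegular (fun x => 𝒥.J.isRegularLocalRing_stalk x) h1)).SameDivisor (m • E) → m = 1 := by
  letI := 𝒥.J.isNoetherian_left
  exact (CartierDivisor.isEffective_prime (fun x => 𝒥.J.isRegularLocalRing_stalk x) h1).forall_eq_one_of_forall_isEffective_eq_one
    (fun x => 𝒥.J.isRegularLocalRing_stalk x) (𝒥.forall_isEffective_eq_one_primeTheta P h1)

/-- **Strong HONE for the prime theta divisor of a complex Jacobian, unconditionally** (smooth projective curve, `dim J ≥ 1`; `h1` = ★ p767754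
`coheight_genericPoint_brillNoetherLocus_eq_one_of_isSmoothProjective`). [cite: Lange2023AbelianVarietiesComplex, §4.2.1 Lemma 4.2.1 (ii) and Cor. 4.2.4] -/
theorem forall_eq_one_primeTheta_of_isSmoothProjective {C : SchemeOver ℂ} [IsIntegral C.left] [IsLocallyNoetherian C.left] (𝒥 : Jacobian C)
    (hC : IsSmoothProjective 1 C) (hdim : 1 ≤ 𝒥.J.dim) (P : AlgPoints C ℂ) :
    letI := 𝒥.J.isNoetherian_left
    letI : GeometricallyIrreducible C.hom := hC.geometricallyIrreducible
    ∀ (E : CartierDivisor 𝒥.J.X.left) (m : ℕ), 0 < m →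
      (CartierDivisor.ofIsEffectiveCartier (primeDivisorIdeal (𝒥.isIrreducible_brillNoetherLocus P (𝒥.J.dim - 1)).genericPoint)
        (isEffectiveCartier_primeDivisorIdeal_of_isRegular (fun x => 𝒥.J.isRegularLocalRing_stalk x)
          (𝒥.coheight_genericPoint_brillNoetherLocus_eq_one_of_isSmoothProjective hC hdim P))).SameDivisor (m • E) → m = 1 := by
  letI : GeometricallyIrreducible C.hom := hC.geometricallyIrreducible
  exact 𝒥.forall_eq_one_primeTheta P (𝒥.coheight_genericPoint_brillNoetherLocus_eq_one_of_isSmoothProjective hC hdim P)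

end Jacobian

end Literature.AlgebraicGeometry.Motives

end
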